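import Summits.Schanuel.Schanuel.Theorems.RootDecomp1EPointTransfer03
import Summits.Schanuel.Schanuel.Theses.RootDecomp1K

/-!
# RootDecomp1EPointTransfer — lens 2, generation 36 «POINT-TRANSFER CELL» (PointTransfer.lean v2 3559bc07…, 1387 l) — continuation (RootDecomp1EPointTransfer04): §6b plainness of `zH3`, the items 31410 / 25020 APPLIED and the cross-route 31077 links (this part alone imports `…Theses.RootDecomp1K`); §7 rates (`UltraRatScale`, `lambdaH_convergent`); §7b SEPARATION `not_ultraLiouville_lambdaH`, `lambdaH_rat_lower`, `hyper_not_ultra_lambdaH` (hypothesis-free)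

(lens-2 g36 `PointTransfer.lean` v2, sha256 3559bc07…2e21, own farm rc 0 · 0 sorry · axioms std; critic VERDICT STATUS L1667 PORT GO LOW;
port by census-1 gen 15 in four parts `RootDecomp1EPointTransfer01`–`04` — see the PORT NOTE of part 01; `--supports stmt-Schanuel-31409`; rung 0.)
-/

noncomputable section

open Complex IntermediateField
open Summit.Schanuel.Schanuel.Theorems.RootDecomp1KHyper (SB SFset mvlen mvlen_nonneg abs_coeff_le_mvlen
  one_le_mvlen sb_of_algebraicIndependent exists_le_two_pow exists_int_mul_eq_map mvaeval_int_map
  mem_adjoin_SFset_I')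
open Summit.Schanuel.Schanuel.Theorems.RootDecomp1KHyper.HyperCell (HyperLiouville hexp hexp_succ lambdaH
  hyperLiouville_lambdaH lambdaH_partialSum lambdaH_tail_pos lambdaH_tail_le lambdaH_eq_partialSum_add_tail
  summable_lambdaH succ_le_hexp one_le_hexp)
open Summit.Schanuel.Schanuel.Theorems.RootDecomp1EScaleTransfer (expPoly prod_exp_pow_eq expPoly_eq_sum
  differentiable_expPoly exists_lipschitz_expPoly linearIndependent_scale linearIndependent_of_scale s2 s2_mul_s2 ω4 y3
  isAlgebraic_s2 ω4_algebraic ω4_linearIndependent y3_linearIndependent s2_not_rat y3_zero y3_one y3_two ih_at_three)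

namespace Summit.Schanuel.Schanuel.Theorems.RootDecomp1EPointTransfer

/-- `a + b√2 = 0` with `a, b ∈ ℚ` forces `a = b = 0`. -/
private theorem rat_sqrt_two {a b : ℚ} (h : (a : ℝ) + b * Real.sqrt 2 = 0) : a = 0 ∧ b = 0 := by
  by_cases hb : b = 0
  · subst hb
    simp at h
    exact ⟨by exact_mod_cast h, rfl⟩
  · exfalso
    apply irrational_sqrt_two
    refine ⟨-a / b, ?_⟩
    have hb' : (b : ℝ) ≠ 0 := by exact_mod_cast hb
    push_cast
    field_simp
    linarith

/-- `λ_H > 0`. -/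
private theorem lambdaH_pos : 0 < lambdaH :=
  summable_lambdaH.tsum_pos (fun k => by positivity) 0 (by positivity)

/-- `λ_H ≠ 0` in `ℂ`. -/
private theorem lambdaH_ne_zero : (lambdaH : ℂ) ≠ 0 := Complex.ofReal_ne_zero.mpr lambdaH_pos.ne'

/-! ### §6b Plainness of `z_H⁽³⁾`, the induction binder at `n = 3`, the items APPLIED -/

/-- Coordinates in the ℚ-span of `z_H⁽³⁾`: `v = λ_H (a + b√2 + c i)` with `a, b, c ∈ ℚ`. -/
theorem span_zH3_coords {v : ℂ} (hv : v ∈ Submodule.span ℚ (Set.range zH3)) :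
    ∃ a b c : ℚ, v = (lambdaH : ℂ) * ((a : ℂ) + (b : ℂ) * s2 + (c : ℂ) * I) := by
  obtain ⟨c, rfl⟩ := (Submodule.mem_span_range_iff_exists_fun ℚ).mp hv
  refine ⟨c 0, c 1, c 2, ?_⟩
  rw [Fin.sum_univ_three]
  simp only [zH3, y3_zero, y3_one, y3_two, Rat.smul_def]
  ring

/-- **Plainness certificate of `z_H⁽³⁾`:** an algebraic `β` with `β · z_H⁽³⁾ ⊆ span_ℚ z_H⁽³⁾` is rational. -/
theorem zH3_plain : ∀ β : ℂ, IsAlgebraic ℚ β →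
    (∀ i, β * zH3 i ∈ Submodule.span ℚ (Set.range zH3)) → β ∈ Set.range (algebraMap ℚ ℂ) := by
  intro β _ hβ
  have hξ := lambdaH_ne_zero
  obtain ⟨a0, a1, a2, h0⟩ := span_zH3_coords (hβ 0)
  obtain ⟨b0, b1, b2, h1⟩ := span_zH3_coords (hβ 1)
  obtain ⟨d0, d1, d2, h2⟩ := span_zH3_coords (hβ 2)
  rw [show zH3 0 = (lambdaH : ℂ) * 1 from rfl] at h0
  rw [show zH3 1 = (lambdaH : ℂ) * s2 from rfl] at h1
  rw [show zH3 2 = (lambdaH : ℂ) * I from rfl] at h2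
  have cancel : ∀ {p q : ℂ}, (lambdaH : ℂ) * p = (lambdaH : ℂ) * q → p = q :=
    fun h => mul_left_cancel₀ hξ h
  have hβeq : β = (a0 : ℂ) + (a1 : ℂ) * s2 + (a2 : ℂ) * I :=
    cancel (by linear_combination h0)
  have h2' : β * I = (d0 : ℂ) + (d1 : ℂ) * s2 + (d2 : ℂ) * I :=
    cancel (by linear_combination h2)
  have h1' : β * s2 = (b0 : ℂ) + (b1 : ℂ) * s2 + (b2 : ℂ) * I :=
    cancel (by linear_combination h1)
  rw [hβeq] at h2' h1'
  have him2 := congrArg Complex.im h2'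
  simp [s2] at him2
  have ha1 : a1 = 0 :=
    (rat_sqrt_two (a := a0 - d2) (b := a1) (by push_cast; linarith)).2
  have him1 := congrArg Complex.im h1'
  simp [s2] at him1
  have ha2 : a2 = 0 :=
    (rat_sqrt_two (a := -b2) (b := a2) (by push_cast; linarith)).2
  refine ⟨a0, ?_⟩
  rw [eq_ratCast, hβeq, ha1, ha2]; push_cast; ring

/-- **Item 31410 `PlainDefectOne` APPLIED to `z_H⁽³⁾`, ALL hypotheses discharged.** -/
theorem item31410_applied_at_zH3 (h31410 : Summit.Schanuel.Schanuel.Theses.RootDecomp1E.PlainDefectOne) :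
    ((3 : ℕ) : Cardinal) ≤ Algebra.trdeg ℚ ↥(IntermediateField.adjoin ℚ
        (Set.range zH3 ∪ Set.range (Complex.exp ∘ zH3))) + 1 :=
  h31410 3 zH3 zH3_linearIndependent zH3_plain (ih_at_three zH3)

/-- … and the cell theorem proves that instance (mod `hRoy`). -/
theorem item31410_instance_at_zH3 (hRoy : Roy2014_thm_1_1) :
    ((3 : ℕ) : Cardinal) ≤ Algebra.trdeg ℚ ↥(IntermediateField.adjoin ℚ
        (Set.range zH3 ∪ Set.range (Complex.exp ∘ zH3))) + 1 :=
  plainDefectOne_pointCell hRoy 3 zH3 zH3_linearIndependent zH3_inPointClass zH3_plain (ih_at_three zH3)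

/-- **Item 25020 `DefectOneSchanuel` (S⁻) APPLIED to `z_H⁽³⁾`.** -/
theorem item25020_applied_at_zH3 (h25020 : Summit.Schanuel.Schanuel.Theses.RootDecomp1E.DefectOneSchanuel) :
    ((3 : ℕ) : Cardinal) ≤ Algebra.trdeg ℚ ↥(IntermediateField.adjoin ℚ
        (Set.range zH3 ∪ Set.range (Complex.exp ∘ zH3))) + 1 :=
  h25020 3 zH3 zH3_linearIndependent

/-- … and the cell theorem proves that instance (mod `hRoy`); indeed `S` itself (`schanuel_at_zH3`). -/
theorem item25020_instance_at_zH3 (hRoy : Roy2014_thm_1_1) :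
    ((3 : ℕ) : Cardinal) ≤ Algebra.trdeg ℚ ↥(IntermediateField.adjoin ℚ
        (Set.range zH3 ∪ Set.range (Complex.exp ∘ zH3))) + 1 :=
  defectOneSchanuel_pointCell hRoy 3 zH3 zH3_linearIndependent zH3_inPointClass

/-- **Route 1K's item 31077 `CoordLiouvilleSchanuel` (S_L′, rank 2) APPLIED to `z_H⁽⁴⁾`**, all scope
hypotheses discharged (`zH4_coordLiouville`). -/
theorem item31077_applied_at_zH4 (h31077 : Summit.Schanuel.Schanuel.Theses.RootDecomp1K.CoordLiouvilleSchanuel) :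
    ((4 : ℕ) : Cardinal) ≤ Algebra.trdeg ℚ ↥(IntermediateField.adjoin ℚ
        (Set.range zH4 ∪ Set.range (Complex.exp ∘ zH4))) :=
  h31077 4 zH4 zH4_linearIndependent zH4_coordLiouville

/-- … and the cell theorem proves that instance (mod `hRoy`). -/
theorem item31077_instance_at_zH4 (hRoy : Roy2014_thm_1_1) :
    ((4 : ℕ) : Cardinal) ≤ Algebra.trdeg ℚ ↥(IntermediateField.adjoin ℚ
        (Set.range zH4 ∪ Set.range (Complex.exp ∘ zH4))) :=
  coordLiouvilleSchanuel_pointCell hRoy 4 zH4 zH4_linearIndependent zH4_inPointClass zH4_coordLiouville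

/-- Route 1K's item 31077 `CoordLiouvilleSchanuel` APPLIED to `z_H⁽³⁾` (scope hypotheses discharged). -/
theorem item31077_applied_at_zH3 (h31077 : Summit.Schanuel.Schanuel.Theses.RootDecomp1K.CoordLiouvilleSchanuel) :
    ((3 : ℕ) : Cardinal) ≤ Algebra.trdeg ℚ ↥(IntermediateField.adjoin ℚ
        (Set.range zH3 ∪ Set.range (Complex.exp ∘ zH3))) :=
  h31077 3 zH3 zH3_linearIndependent zH3_coordLiouville

/-- … and the cell theorem proves that instance at `z_H⁽³⁾` (mod `hRoy`). -/
theorem item31077_instance_at_zH3 (hRoy : Roy2014_thm_1_1) :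
    ((3 : ℕ) : Cardinal) ≤ Algebra.trdeg ℚ ↥(IntermediateField.adjoin ℚ
        (Set.range zH3 ∪ Set.range (Complex.exp ∘ zH3))) :=
  coordLiouvilleSchanuel_pointCell hRoy 3 zH3 zH3_linearIndependent zH3_inPointClass zH3_coordLiouville

/-- Literal member read-outs. -/
theorem zH4_def (j : Fin 4) : zH4 j = (lambdaH : ℂ) * ![(1 : ℂ), (Real.sqrt 2 : ℂ), I, I * (Real.sqrt 2 : ℂ)] j := rfl
/-- Literal read-out of `z_H⁽³⁾`. -/
theorem zH3_def (j : Fin 3) :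
    zH3 j = (lambdaH : ℂ) * ![(1 : ℂ), (Real.sqrt 2 : ℂ), I, I * (Real.sqrt 2 : ℂ)] (Fin.castSucc j) := rfl
/-- Literal read-out of `λ_H = Σ_k 2^{-hexp k}`. -/
theorem lambdaH_def : lambdaH = ∑' k, 1 / (2 : ℝ) ^ hexp k := rfl

/-! ## §7 RATES and SEPARATION: the class is single-exponential; `λ_H` is NOT ultra-Liouville -/

/-- The doubly-exponential analogue (g35's rate, through ℚ): `‖ξ − r‖ < exp(−exp((2 + |num r| + den r)^m))`. -/
def UltraRatScale (ξ : ℂ) : Prop :=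
  ∀ m : ℕ, ∃ r : ℚ, r ≠ 0 ∧ ‖ξ - (r : ℂ)‖ < Real.exp (-Real.exp ((2 + |(r.num : ℝ)| + r.den) ^ m))

/-- Doubly-exponential approximability implies the single-exponential one (the new class is LARGER). -/
theorem UltraRatScale.hyperRatScale {ξ : ℂ} (h : UltraRatScale ξ) : HyperRatScale ξ := by
  intro m
  obtain ⟨r, hr0, hlt⟩ := h m
  refine ⟨r, hr0, hlt.trans_le (Real.exp_le_exp.mpr (neg_le_neg ?_))⟩
  linarith [Real.add_one_le_exp ((2 + |(r.num : ℝ)| + r.den) ^ m)]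

/-- The tail from `N` on is at least its first term. -/
theorem lambdaH_tail_ge (N : ℕ) : 1 / (2 : ℝ) ^ hexp N ≤ ∑' k, 1 / (2 : ℝ) ^ hexp (k + N) := by
  have hs : Summable fun k => 1 / (2 : ℝ) ^ hexp (k + N) :=
    (summable_nat_add_iff N).mpr summable_lambdaH
  have := hs.le_tsum 0 (fun k _ => by positivity)
  simpa using this

/-- **The member scale's convergents**: `s_K = Σ_{k ≤ K} 2^{−a_k} = M_K / 2^{a_K}` (`M_K` odd) with
`2^{−a_{K+1}} ≤ λ_H − s_K ≤ 2 · 2^{−a_{K+1}}`, `a_{K+1} = 2^{(K+1)·a_K}`: in the denominator `q_K = 2^{a_K}` the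
error is `exp(−Θ(q_K^{K+1}))` — SINGLE-exponential of order `K + 1`, not `exp(−exp(q_K^m))`. -/
theorem lambdaH_convergent (K : ℕ) :
    ∃ M : ℕ, Odd M ∧ (∑ k ∈ Finset.range (K + 1), 1 / (2 : ℝ) ^ hexp k) = M / (2 : ℝ) ^ hexp K ∧
      1 / (2 : ℝ) ^ hexp (K + 1) ≤ lambdaH - ∑ k ∈ Finset.range (K + 1), 1 / (2 : ℝ) ^ hexp k ∧
      lambdaH - ∑ k ∈ Finset.range (K + 1), 1 / (2 : ℝ) ^ hexp k ≤ 2 * (1 / (2 : ℝ) ^ hexp (K + 1)) ∧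
      hexp (K + 1) = 2 ^ ((K + 1) * hexp K) := by
  obtain ⟨M, hModd, hsum⟩ := lambdaH_partialSum K
  have htail : lambdaH - ∑ k ∈ Finset.range (K + 1), 1 / (2 : ℝ) ^ hexp k =
      ∑' k, 1 / (2 : ℝ) ^ hexp (k + (K + 1)) := by
    rw [lambdaH_eq_partialSum_add_tail (K + 1)]; ring
  refine ⟨M, hModd, hsum, ?_, ?_, hexp_succ K⟩
  · rw [htail]; exact lambdaH_tail_ge (K + 1)
  · rw [htail]; exact lambdaH_tail_le (K + 1)

/-! ### §7b SEPARATION (hypothesis-free): `λ_H` is NOT doubly-exponentially approximable by rationals -/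

/-- lens 4's predicate (HOME `decomp-schanuel-lens-4/g31/RadicalDescent.lean` l. 579, TEXT VERBATIM; not yet
in the tree): DOUBLY-exponential («ultra-Liouville») rational approximability of every order. -/
def UltraLiouville (ρ : ℝ) : Prop :=
  ∀ m : ℕ, ∃ r : ℚ, m ≤ r.den ∧ ρ ≠ r ∧ |ρ - r| < Real.exp (-Real.exp ((r.den : ℝ) ^ m))

/-- `2a + 2 ≤ 2^{2a}` for `a ≥ 1`. -/
theorem two_mul_add_two_le_pow {a : ℕ} (ha : 1 ≤ a) : 2 * a + 2 ≤ 2 ^ (2 * a) := by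
  have h1 : a + 1 ≤ 2 ^ a := Nat.lt_two_pow_self
  calc 2 * a + 2 ≤ (a + 1) * (a + 1) := by nlinarith
    _ ≤ 2 ^ a * 2 ^ a := Nat.mul_le_mul h1 h1
    _ = 2 ^ (2 * a) := by rw [← pow_add]; ring_nf

/-- If `2^{a_K} ≤ q` then `a_{K+1} ≤ 2^{q²}` (`a_{K+1} = 2^{(K+1)a_K} ≤ (2^{a_K})^{a_K} ≤ q^{a_K} ≤ q^q`). -/
theorem hexp_succ_le_of_le {K q : ℕ} (h : 2 ^ hexp K ≤ q) : hexp (K + 1) ≤ 2 ^ (q * q) := by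
  have hq : 0 < q := lt_of_lt_of_le (Nat.two_pow_pos _) h
  have haK : hexp K ≤ q := (Nat.lt_two_pow_self).le.trans h
  rw [hexp_succ]
  calc 2 ^ ((K + 1) * hexp K) ≤ 2 ^ (hexp K * hexp K) :=
        Nat.pow_le_pow_right two_pos (Nat.mul_le_mul_right _ (succ_le_hexp K))
    _ = (2 ^ hexp K) ^ hexp K := by rw [pow_mul]
    _ ≤ q ^ hexp K := Nat.pow_le_pow_left h _
    _ ≤ q ^ q := Nat.pow_le_pow_right hq haK
    _ ≤ (2 ^ q) ^ q := Nat.pow_le_pow_left (Nat.lt_two_pow_self).le _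
    _ = 2 ^ (q * q) := by rw [← pow_mul]

/-- **Lower bound at the scale of the convergents.**  If `den r < 2^{a_{K+1}}` then
`|λ_H − r| ≥ 1 / (2 · 4^{a_{K+1}})`: `r ≠ s_{K+1} = M/2^{a_{K+1}}` (`M` odd, `den r < 2^{a_{K+1}}`), so
`|r − s_{K+1}| ≥ 1/(den r · 2^{a_{K+1}}) ≥ 4^{−a_{K+1}}`, while `|λ_H − s_{K+1}| ≤ 2·2^{−a_{K+2}} ≤ ½·4^{−a_{K+1}}`. -/
theorem lambdaH_sub_rat_lower {K : ℕ} (r : ℚ) (hqK : r.den < 2 ^ hexp (K + 1)) :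
    1 / (2 * ((2 : ℝ) ^ hexp (K + 1)) ^ 2) ≤ |lambdaH - r| := by
  obtain ⟨M, hModd, hsum, hlo, hhi, -⟩ := lambdaH_convergent (K + 1)
  set a : ℕ := hexp (K + 1) with ha
  set A : ℝ := (2 : ℝ) ^ a with hA
  set s : ℝ := ∑ k ∈ Finset.range (K + 1 + 1), 1 / (2 : ℝ) ^ hexp k with hs
  have hA0 : 0 < A := by positivity
  have ha1 : 1 ≤ a := one_le_hexp _
  have hq0 : 0 < r.den := r.den_pos
  have hq0R : (0 : ℝ) < r.den := by exact_mod_cast hq0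
  have hqA : (r.den : ℝ) ≤ A := by
    rw [hA]; exact_mod_cast hqK.le
  have hsA : s * A = M := by
    rw [hsum, hA, div_mul_cancel₀]
    positivity
  -- r ≠ s_{K+1}: the numerator p·2^a − q·M is a non-zero integer
  have hne : (r.num : ℤ) * ((2 ^ a : ℕ) : ℤ) - (r.den : ℤ) * M ≠ 0 := by
    intro h
    have hdvd : ((2 ^ a : ℕ) : ℤ) ∣ (r.den : ℤ) * M := ⟨r.num, by linarith⟩
    have hcop : IsCoprime ((2 ^ a : ℕ) : ℤ) (M : ℤ) :=
      Nat.isCoprime_iff_coprime.mpr ((Nat.coprime_two_left.mpr hModd).pow_left a)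
    have h2 : ((2 ^ a : ℕ) : ℤ) ∣ (r.den : ℤ) := hcop.dvd_of_dvd_mul_right hdvd
    have h3 : 2 ^ a ∣ r.den := by exact_mod_cast h2
    exact absurd (Nat.le_of_dvd hq0 h3) (not_le.mpr hqK)
  have hdiff : ((r : ℝ) - s) * (r.den * A) =
      (((r.num : ℤ) * ((2 ^ a : ℕ) : ℤ) - (r.den : ℤ) * M : ℤ) : ℝ) := by
    have h1 : (r : ℝ) * r.den = r.num := by exact_mod_cast Rat.mul_den_eq_num r
    push_cast
    calc ((r : ℝ) - s) * (r.den * A) = (r : ℝ) * r.den * A - s * A * r.den := by ring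
      _ = (r.num : ℝ) * (2 : ℝ) ^ a - (r.den : ℝ) * M := by rw [h1, hsA, hA]; ring
  have hge1 : 1 ≤ |(r : ℝ) - s| * (r.den * A) := by
    have h1 : (1 : ℝ) ≤ |((((r.num : ℤ) * ((2 ^ a : ℕ) : ℤ) - (r.den : ℤ) * M : ℤ)) : ℝ)| := by
      rw [← Int.cast_abs]; exact_mod_cast Int.one_le_abs hne
    rw [← hdiff, abs_mul, abs_of_pos (by positivity : (0 : ℝ) < r.den * A)] at h1
    exact h1
  have hrs : 1 / (r.den * A) ≤ |(r : ℝ) - s| := by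
    rw [div_le_iff₀ (by positivity)]; exact hge1
  -- |λ_H − s_{K+1}| ≤ 2·2^{−a_{K+2}} ≤ 1/(2A²)
  have h2a : 2 * a + 2 ≤ hexp (K + 1 + 1) := by
    rw [hexp_succ (K + 1), ← ha]
    calc 2 * a + 2 ≤ 2 ^ (2 * a) := two_mul_add_two_le_pow ha1
      _ ≤ 2 ^ ((K + 1 + 1) * a) := Nat.pow_le_pow_right two_pos (by nlinarith)
  have htail : |lambdaH - s| ≤ 1 / (2 * A ^ 2) := by
    have hpos : 0 ≤ lambdaH - s := le_trans (by positivity) hlo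
    rw [abs_of_nonneg hpos]
    calc lambdaH - s ≤ 2 * (1 / (2 : ℝ) ^ hexp (K + 1 + 1)) := hhi
      _ ≤ 2 * (1 / (2 : ℝ) ^ (2 * a + 2)) :=
          mul_le_mul_of_nonneg_left
            (one_div_le_one_div_of_le (by positivity) (pow_le_pow_right₀ one_le_two h2a)) (by norm_num)
      _ = 1 / (2 * A ^ 2) := by
          rw [hA, ← pow_mul, pow_add]; field_simp; ring
  -- combine
  have hqA' : 1 / A ^ 2 ≤ 1 / (r.den * A) :=
    one_div_le_one_div_of_le (by positivity) (by rw [sq]; exact mul_le_mul_of_nonneg_right hqA hA0.le)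
  have htri : |(r : ℝ) - s| - |lambdaH - s| ≤ |lambdaH - r| := by
    have := abs_sub_abs_le_abs_sub ((r : ℝ) - s) (lambdaH - s)
    have e : (r : ℝ) - s - (lambdaH - s) = -(lambdaH - r) := by ring
    rw [e, abs_neg] at this
    exact this
  calc 1 / (2 * A ^ 2) = 1 / A ^ 2 - 1 / (2 * A ^ 2) := by field_simp; ring
    _ ≤ |(r : ℝ) - s| - |lambdaH - s| := by linarith
    _ ≤ |lambdaH - r| := htri

/-- **An explicit, SINGLE-exponential-type irrationality measure for `λ_H`**: for every rational `r` with
`den r ≥ 2`, `|λ_H − r| ≥ exp(−exp((den r)³))` (indeed `≥ 2^{−(2·2^{(den r)²} + 1)}`). -/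
theorem lambdaH_rat_lower (r : ℚ) (hq : 2 ≤ r.den) :
    Real.exp (-Real.exp ((r.den : ℝ) ^ 3)) ≤ |lambdaH - r| := by
  set q : ℕ := r.den with hqdef
  have hex : ∃ k, q < 2 ^ hexp (k + 1) :=
    ⟨q, lt_of_lt_of_le (Nat.lt_succ_of_le (Nat.le_succ q))
      ((succ_le_hexp (q + 1)).trans (Nat.lt_two_pow_self).le)⟩
  classical
  obtain ⟨K, hK, hKmin⟩ : ∃ K, q < 2 ^ hexp (K + 1) ∧ ∀ k, k < K → ¬ q < 2 ^ hexp (k + 1) :=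
    ⟨Nat.find hex, Nat.find_spec hex, fun k hk => Nat.find_min hex hk⟩
  have hKle : 2 ^ hexp K ≤ q := by
    rcases Nat.eq_zero_or_pos K with h0 | hpos
    · rw [h0, Summit.Schanuel.Schanuel.Theorems.RootDecomp1KHyper.HyperCell.hexp_zero, pow_one]; exact hq
    · have := hKmin (K - 1) (by omega)
      rw [Nat.sub_add_cancel hpos] at this
      exact not_lt.mp this
  have hlow := lambdaH_sub_rat_lower r hK
  have haq : hexp (K + 1) ≤ 2 ^ (q * q) := hexp_succ_le_of_le hKle
  -- 1/(2·(2^a)²) = 2^{−(2a+1)} ≥ 2^{−N}, N = 2·2^{q²} + 1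
  set N : ℕ := 2 * 2 ^ (q * q) + 1 with hN
  have hNa : 2 * hexp (K + 1) + 1 ≤ N := by rw [hN]; omega
  have h1 : 1 / (2 : ℝ) ^ N ≤ 1 / (2 * ((2 : ℝ) ^ hexp (K + 1)) ^ 2) := by
    have e : 2 * ((2 : ℝ) ^ hexp (K + 1)) ^ 2 = (2 : ℝ) ^ (2 * hexp (K + 1) + 1) := by
      rw [pow_add, pow_mul', pow_one]; ring
    rw [e]
    exact one_div_le_one_div_of_le (by positivity) (pow_le_pow_right₀ one_le_two hNa)
  -- 2^{−N} ≥ e^{−N}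
  have h2 : Real.exp (-(N : ℝ)) ≤ 1 / (2 : ℝ) ^ N := by
    have he : Real.exp (-1 : ℝ) ≤ 1 / 2 := by
      rw [Real.exp_neg, ← one_div]
      exact one_div_le_one_div_of_le two_pos (by linarith [Real.add_one_le_exp (1 : ℝ)])
    calc Real.exp (-(N : ℝ)) = Real.exp (-1) ^ N := by rw [← Real.exp_nat_mul]; ring_nf
      _ ≤ (1 / 2 : ℝ) ^ N := pow_le_pow_left₀ (Real.exp_pos _).le he N
      _ = 1 / (2 : ℝ) ^ N := by rw [one_div_pow]
  -- N ≤ exp(q³)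
  have hq2 : (2 : ℝ) ≤ q := by exact_mod_cast hq
  have h3 : (N : ℝ) ≤ Real.exp ((q : ℝ) ^ 3) := by
    have hpow : ((2 : ℕ) ^ (q * q) : ℝ) ≤ Real.exp ((q * q : ℕ) : ℝ) := by
      have h2e : (2 : ℝ) ≤ Real.exp 1 := by linarith [Real.add_one_le_exp (1 : ℝ)]
      calc ((2 : ℕ) ^ (q * q) : ℝ) = (2 : ℝ) ^ (q * q) := by norm_cast
        _ ≤ Real.exp 1 ^ (q * q) := pow_le_pow_left₀ (by norm_num) h2e _
        _ = Real.exp ((q * q : ℕ) : ℝ) := by rw [← Real.exp_nat_mul, mul_one]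
    have hgap : (3 : ℝ) ≤ Real.exp ((q : ℝ) ^ 3 - (q * q : ℕ)) := by
      have hd : (2 : ℝ) ≤ (q : ℝ) ^ 3 - (q * q : ℕ) := by push_cast; nlinarith
      linarith [Real.add_one_le_exp ((q : ℝ) ^ 3 - (q * q : ℕ))]
    have hsplit : Real.exp ((q : ℝ) ^ 3) = Real.exp ((q : ℝ) ^ 3 - (q * q : ℕ)) * Real.exp ((q * q : ℕ) : ℝ) := by
      rw [← Real.exp_add]; ring_nf
    have hNR : (N : ℝ) = 2 * ((2 : ℕ) ^ (q * q) : ℝ) + 1 := by rw [hN]; push_cast; ring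
    rw [hNR, hsplit]
    have hE0 : (1 : ℝ) ≤ ((2 : ℕ) ^ (q * q) : ℝ) := by exact_mod_cast Nat.one_le_two_pow
    nlinarith [hpow, hgap, hE0]
  calc Real.exp (-Real.exp ((q : ℝ) ^ 3)) ≤ Real.exp (-(N : ℝ)) := Real.exp_le_exp.mpr (neg_le_neg h3)
    _ ≤ 1 / (2 : ℝ) ^ N := h2
    _ ≤ 1 / (2 * ((2 : ℝ) ^ hexp (K + 1)) ^ 2) := h1
    _ ≤ |lambdaH - r| := hlow

/-- **SEPARATION (hypothesis-free): the members' scale `λ_H` is NOT ultra-Liouville** — it is NOT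
doubly-exponentially approximable by rationals (order `3` already fails), while it IS hyper-Liouville
(single-exponential of every order, tree `hyperLiouville_lambdaH`): the member lies BEYOND the reach of
every doubly-exponential («through a number field», g35) transfer and INSIDE the point-transfer class. -/
theorem not_ultraLiouville_lambdaH : ¬ UltraLiouville lambdaH := by
  intro h
  obtain ⟨r, hden, -, hlt⟩ := h 3
  exact absurd hlt (not_lt.mpr (lambdaH_rat_lower r (by omega)))

/-- SEPARATION: `λ_H` is hyper-Liouville but NOT ultra-Liouville (hypothesis-free). -/
theorem hyper_not_ultra_lambdaH : HyperLiouville lambdaH ∧ ¬ UltraLiouville lambdaH :=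
  ⟨hyperLiouville_lambdaH, not_ultraLiouville_lambdaH⟩

end Summit.Schanuel.Schanuel.Theorems.RootDecomp1EPointTransfer
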